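import Summits.NavierStokesRegularity.FluidComputer.PalasekTowerRegister
import Literature.Analysis.FluidPDE.BurgersVortexPeakSpeed

/-!
# REGISTER v2.3′: the BURGERS NUMBER of the child crux `HeredityFromTwo`
# (the register's ceiling constant `c₂` and floor constant `c₁` read on a strained vortex core)

Evidence toward `stmt-NavierStokesRegularity-19250` (`PalasekTowerBreakdown.HeredityFromTwo :=
HeredityFrom 2`; registered skeleton `Cruxes/HeredityFromTwo/Lines/birth.lean`, stubs
`stub_continuation_envelope` / `stub_readout_floors`; companions `PalasekTowerRegisterGlobalCeiling`
— the upper half `AprioriCeiling` «no overshoot of `c₂ Y_{k+1}`» — and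
`PalasekTowerRegisterGlobalKatoWindow`). Cell `ns-blowup`, seat `ns-blowup-ecbridge-8` (g3). LABEL: MODEL-side
register arithmetic over a landed Literature theorem (the uniform peak swirl speed of the Burgers
vortex, `Literature/Analysis/FluidPDE/BurgersVortexPeakSpeed.lean`: for strain `γ > 0`, viscosity
`ν > 0`, circulation `Γ`, EVERY point has swirl speed `≤ |Γ|(γ/ν)^{1/2}/(4√2 π)` and SOME point has
`≥ 0.632 |Γ|(γ/ν)^{1/2}/(4π)`; printed sharp value `0.638 |Γ|(γ/ν)^{1/2}/(4π)`, Saffman 1992 §13.1 (4)).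

WHAT THIS IS NOT: not NS — the Burgers vortex is an exact steady INFINITE-ENERGY solution and is no
registered stage; nothing is asserted about any registered flow, about `AprioriCeiling`,
`ReadoutFloors` or the truth of the child crux. The file quantifies the register's constants
(`c₁ = 1` floors, `c₂ = 5/3` ceiling, `Schedule.Rigid`) against the compaction mechanism the lower
half bets on, in the following MODEL identification: «the level-`(k+1)` core is a Burgers vortex
carrying circulation `C · N_{k+1}^{β−2}` (the child's core-ledger scale; `C ≥ c₁` is what
`CoreLedger` demands of its loop, `C ≤ 8πc₂` is the ceiling's Kelvin cap) equilibrated at `ν = 1` in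
the strain `λ · A_k` of the parent (`λ ≥ c₁` at the parent's strain floor point)».

## The one identity and its exponent (§1)

For every admissible `TowerRates` (`N_{k+1} = N_k^b`, `A_k = N_k^β`, `Y_k = N_k^{β−1}`):

  `N_{k+1}^{β−2} · A_k^{1/2} = N_k^{β/2 − b} · Y_{k+1}`      (`palasekTowerBreakdown_burgers_scaling`),

so the Burgers peak of the child core is `(μ/4π) · C√λ · N_k^{β/2 − b} · Y_{k+1}` with
`0.632 ≤ μ ≤ 0.708`, against the ceiling `c₂ Y_{k+1}` of the upper half and the velocity floor
`c₁ Y_{k+1}` of the lower half. Palasek's admissibility `2b < β` makes the BURGERS EXPONENT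
`β/2 − b` POSITIVE on every tower (`_burgers_exponent_pos`; `= 1/20` on the wide rates): the
Burgers number `C√λ · N_k^{β/2 − b}` GROWS along the tower — the typed form of «constants drifting
with k» (refuter4 on 19250): for every fixed `C, λ > 0` and every `c₂`, a Burgers child core
overshoots `c₂ Y_{k+1}` at all large levels (`_burgers_eventually_overshoot`).

## Thresholds (§2) and the band (§3)

With `P := C√λ · N_k^{β/2−b}`: no overshoot of `c₂Y_{k+1}` anywhere on the profile if
`P ≤ 4√2π·c₂`; overshoot somewhere if `P > (500π/79)·c₂`; the velocity floor `c₁Y_{k+1}` is met ON the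
core if `P ≥ (500π/79)·c₁` and missed EVERYWHERE on the profile if `P < 4√2π·c₁`. Hence a Burgers child
core that meets the velocity floor by its own swirl without overshooting has
`4√2π·c₁ ≤ P ≤ (500π/79)·c₂` — under `Schedule.Rigid` (`c₁ = 1`, `c₂ = 5/3`) the certified band
`17 < C√λ·N_k^{1/20} < 34` (sharp: `[19.7, 32.8]`, width exactly `c₂/c₁ = 5/3`; at `k = 2`,
`N_2^{1/20} ≈ 1.40`: `C√λ ∈ [14, 23]`). Below the band the velocity floor must sit OFF the core; the
register's own demand on the child loop is only `C ≥ c₁ = 1`.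

## The same-level reading (§4)

A level-`j` core in its OWN strain `λ'·A_j`: `N_j^{β−2} A_j^{1/2} = (N_j^{β−2})^{1/2} · Y_j`, i.e. the
Burgers number is `C√λ' · Re_j^{1/2}` with `Re_j = N_j^{β−2}` the register's core Reynolds number
(`5.3, 6.2, 7.5, …` on wide) — it, too, grows without bound.

References: P. G. Saffman, *Vortex Dynamics*, CUP 1992, §13.1 (3)–(4), §13.3 (9), (12), (31)
[cite: Saffman1992, §13.1 eq. (4)]; S. Palasek, arXiv:2605.13827, §3 (3.2) (`2b < β`)
[cite: Palasek2026ElementaryModel, §3 (3.2)].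
-/

namespace Summit.NavierStokesRegularity.FluidComputer.PalasekTowerClayBridge

open Real Filter Topology
open Literature.Analysis.FluidPDE

/-! ## §1 The scaling identity and the Burgers exponent -/

/-- **Palasek's admissibility `2b < β` makes the Burgers exponent positive**: `0 < β/2 − b` for every
admissible rates record. -/
theorem palasekTowerBreakdown_burgers_exponent_pos (R : TowerRates) : 0 < R.β / 2 - R.b := by
  have h := R.two_b_lt_β
  linarith

/-- On the wide rates (`b = 11/10`, `β = 23/10`) the Burgers exponent is `1/20`. -/
theorem palasekTowerBreakdown_burgers_exponent_wide :
    TowerRates.wide.β / 2 - TowerRates.wide.b = 1 / 20 := by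
  simp only [TowerRates.wide]
  norm_num

/-- `A_k^{1/2} = N_k^{β/2}`. -/
theorem palasekTowerBreakdown_sqrt_A (R : TowerRates) (k : ℕ) :
    Real.sqrt (R.A k) = R.N k ^ (R.β / 2) := by
  rw [TowerRates.A, Real.sqrt_eq_rpow, ← Real.rpow_mul (R.N_pos k).le]
  congr 1
  ring

/-- **The scaling identity**: `N_{k+1}^{β−2} · A_k^{1/2} = N_k^{β/2 − b} · Y_{k+1}` — the child's
circulation scale times the square root of the parent's strain is the child's velocity scale times
the Burgers factor `N_k^{β/2−b}`. -/
theorem palasekTowerBreakdown_burgers_scaling (R : TowerRates) (k : ℕ) :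
    R.N (k + 1) ^ (R.β - 2) * Real.sqrt (R.A k) = R.N k ^ (R.β / 2 - R.b) * R.Y (k + 1) := by
  have hN := R.N_pos k
  rw [palasekTowerBreakdown_sqrt_A, TowerRates.Y, R.N_succ k, ← Real.rpow_mul hN.le,
    ← Real.rpow_mul hN.le, ← Real.rpow_add hN, ← Real.rpow_add hN]
  congr 1
  ring

/-- The Burgers factor exceeds one at every level (`N_k > 1`, exponent `> 0`). -/
theorem palasekTowerBreakdown_one_lt_burgersFactor (R : TowerRates) (k : ℕ) :
    1 < R.N k ^ (R.β / 2 - R.b) :=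
  Real.one_lt_rpow (R.one_lt_N k) (palasekTowerBreakdown_burgers_exponent_pos R)

/-- **The Burgers factor diverges along the tower.** -/
theorem palasekTowerBreakdown_tendsto_burgersFactor (R : TowerRates) :
    Tendsto (fun k => R.N k ^ (R.β / 2 - R.b)) atTop atTop :=
  (tendsto_rpow_atTop (palasekTowerBreakdown_burgers_exponent_pos R)).comp R.tendsto_N_atTop

/-! ## §2 The Burgers child core against the level-`(k+1)` ceiling and velocity floor

The MODEL object: `burgersVortexSwirl (λ * R.A k) 1 (C * R.N (k + 1) ^ (R.β - 2))` — the swirl of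
the Burgers vortex with strain `λ A_k`, unit viscosity and circulation `C N_{k+1}^{β−2}`. -/

/-- **Peak of the Burgers child core (upper)**: every point has swirl speed
`≤ C√λ · N_k^{β/2−b} · Y_{k+1} / (4√2 π)`. -/
theorem palasekTowerBreakdown_burgers_peak_le (R : TowerRates) (k : ℕ) {C l : ℝ} (hC : 0 ≤ C)
    (hl : 0 < l) (x : EuclideanSpace ℝ (Fin 3)) :
    ‖burgersVortexSwirl (l * R.A k) 1 (C * R.N (k + 1) ^ (R.β - 2)) x‖ ≤
      C * Real.sqrt l * R.N k ^ (R.β / 2 - R.b) * R.Y (k + 1) / (4 * Real.sqrt 2 * π) := by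
  have hA := R.A_pos k
  have h := norm_burgersVortexSwirl_le_peak (mul_pos hl hA) one_pos (C * R.N (k + 1) ^ (R.β - 2)) x
  have hΓ : 0 ≤ C * R.N (k + 1) ^ (R.β - 2) := mul_nonneg hC (Real.rpow_nonneg (R.N_pos _).le _)
  rw [abs_of_nonneg hΓ, div_one, Real.sqrt_mul hl.le] at h
  calc ‖burgersVortexSwirl (l * R.A k) 1 (C * R.N (k + 1) ^ (R.β - 2)) x‖
      ≤ C * R.N (k + 1) ^ (R.β - 2) * (Real.sqrt l * Real.sqrt (R.A k)) / (4 * Real.sqrt 2 * π) := h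
    _ = C * Real.sqrt l * (R.N (k + 1) ^ (R.β - 2) * Real.sqrt (R.A k)) / (4 * Real.sqrt 2 * π) := by
      ring
    _ = C * Real.sqrt l * R.N k ^ (R.β / 2 - R.b) * R.Y (k + 1) / (4 * Real.sqrt 2 * π) := by
      rw [palasekTowerBreakdown_burgers_scaling]; ring

/-- **Peak of the Burgers child core (lower)**: some point has swirl speed
`≥ (79/125) · C√λ · N_k^{β/2−b} · Y_{k+1} / (4π)` (`79/125 = 0.632 ≤ 1 − e^{−1}`). -/
theorem palasekTowerBreakdown_burgers_peak_ge (R : TowerRates) (k : ℕ) {C l : ℝ} (hC : 0 ≤ C)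
    (hl : 0 < l) :
    ∃ x : EuclideanSpace ℝ (Fin 3),
      79 / 125 * (C * Real.sqrt l * R.N k ^ (R.β / 2 - R.b) * R.Y (k + 1) / (4 * π)) ≤
        ‖burgersVortexSwirl (l * R.A k) 1 (C * R.N (k + 1) ^ (R.β - 2)) x‖ := by
  have hA := R.A_pos k
  obtain ⟨x, hx⟩ :=
    exists_norm_burgersVortexSwirl_ge (mul_pos hl hA) one_pos (C * R.N (k + 1) ^ (R.β - 2))
  have hΓ : 0 ≤ C * R.N (k + 1) ^ (R.β - 2) := mul_nonneg hC (Real.rpow_nonneg (R.N_pos _).le _)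
  rw [abs_of_nonneg hΓ, div_one, Real.sqrt_mul hl.le] at hx
  refine ⟨x, le_of_eq_of_le ?_ hx⟩
  rw [show C * R.N (k + 1) ^ (R.β - 2) * (Real.sqrt l * Real.sqrt (R.A k)) =
      C * Real.sqrt l * (R.N (k + 1) ^ (R.β - 2) * Real.sqrt (R.A k)) by ring,
    palasekTowerBreakdown_burgers_scaling]
  ring

/-- **No overshoot of `c₂ Y_{k+1}` anywhere on the Burgers child core** as soon as
`C√λ · N_k^{β/2−b} ≤ 4√2π · c₂` (`4√2π = 17.77…`; with `c₂ = 5/3`: `29.6`). -/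
theorem palasekTowerBreakdown_burgers_noOvershoot (R : TowerRates) (k : ℕ) {C l c₂ : ℝ} (hC : 0 ≤ C)
    (hl : 0 < l) (hP : C * Real.sqrt l * R.N k ^ (R.β / 2 - R.b) ≤ 4 * Real.sqrt 2 * π * c₂)
    (x : EuclideanSpace ℝ (Fin 3)) :
    ‖burgersVortexSwirl (l * R.A k) 1 (C * R.N (k + 1) ^ (R.β - 2)) x‖ ≤ c₂ * R.Y (k + 1) := by
  have hY : 0 < R.Y (k + 1) := Real.rpow_pos_of_pos (R.N_pos _) _
  have hden : 0 < 4 * Real.sqrt 2 * π := by positivity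
  refine (palasekTowerBreakdown_burgers_peak_le R k hC hl x).trans ?_
  rw [div_le_iff₀ hden]
  calc C * Real.sqrt l * R.N k ^ (R.β / 2 - R.b) * R.Y (k + 1)
      ≤ 4 * Real.sqrt 2 * π * c₂ * R.Y (k + 1) := mul_le_mul_of_nonneg_right hP hY.le
    _ = c₂ * R.Y (k + 1) * (4 * Real.sqrt 2 * π) := by ring

/-- **Overshoot of `c₂ Y_{k+1}` somewhere on the Burgers child core** as soon as
`C√λ · N_k^{β/2−b} > (500π/79) · c₂` (`500π/79 = 19.88…`; with `c₂ = 5/3`: `33.1`). -/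
theorem palasekTowerBreakdown_burgers_overshoot (R : TowerRates) (k : ℕ) {C l c₂ : ℝ} (hC : 0 ≤ C)
    (hl : 0 < l) (hP : 500 * π / 79 * c₂ < C * Real.sqrt l * R.N k ^ (R.β / 2 - R.b)) :
    ∃ x : EuclideanSpace ℝ (Fin 3),
      c₂ * R.Y (k + 1) < ‖burgersVortexSwirl (l * R.A k) 1 (C * R.N (k + 1) ^ (R.β - 2)) x‖ := by
  obtain ⟨x, hx⟩ := palasekTowerBreakdown_burgers_peak_ge R k hC hl
  have hY : 0 < R.Y (k + 1) := Real.rpow_pos_of_pos (R.N_pos _) _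
  have hpi := Real.pi_pos
  refine ⟨x, lt_of_lt_of_le ?_ hx⟩
  have h1 : c₂ < 79 / 125 * (C * Real.sqrt l * R.N k ^ (R.β / 2 - R.b)) / (4 * π) := by
    rw [lt_div_iff₀ (by positivity)]
    nlinarith
  calc c₂ * R.Y (k + 1) < 79 / 125 * (C * Real.sqrt l * R.N k ^ (R.β / 2 - R.b)) / (4 * π) * R.Y (k + 1) :=
        mul_lt_mul_of_pos_right h1 hY
    _ = 79 / 125 * (C * Real.sqrt l * R.N k ^ (R.β / 2 - R.b) * R.Y (k + 1) / (4 * π)) := by ring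

/-- **The velocity floor `c₁ Y_{k+1}` is met ON the Burgers child core** as soon as
`C√λ · N_k^{β/2−b} ≥ (500π/79) · c₁` (`= 19.88…` for `c₁ = 1`). -/
theorem palasekTowerBreakdown_burgers_floor (R : TowerRates) (k : ℕ) {C l c₁ : ℝ} (hC : 0 ≤ C)
    (hl : 0 < l) (hP : 500 * π / 79 * c₁ ≤ C * Real.sqrt l * R.N k ^ (R.β / 2 - R.b)) :
    ∃ x : EuclideanSpace ℝ (Fin 3),
      c₁ * R.Y (k + 1) ≤ ‖burgersVortexSwirl (l * R.A k) 1 (C * R.N (k + 1) ^ (R.β - 2)) x‖ := by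
  obtain ⟨x, hx⟩ := palasekTowerBreakdown_burgers_peak_ge R k hC hl
  have hY : 0 < R.Y (k + 1) := Real.rpow_pos_of_pos (R.N_pos _) _
  have hpi := Real.pi_pos
  refine ⟨x, le_trans ?_ hx⟩
  have h1 : c₁ ≤ 79 / 125 * (C * Real.sqrt l * R.N k ^ (R.β / 2 - R.b)) / (4 * π) := by
    rw [le_div_iff₀ (by positivity)]
    nlinarith
  calc c₁ * R.Y (k + 1) ≤ 79 / 125 * (C * Real.sqrt l * R.N k ^ (R.β / 2 - R.b)) / (4 * π) * R.Y (k + 1) :=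
        mul_le_mul_of_nonneg_right h1 hY.le
    _ = 79 / 125 * (C * Real.sqrt l * R.N k ^ (R.β / 2 - R.b) * R.Y (k + 1) / (4 * π)) := by ring

/-- **The velocity floor is missed EVERYWHERE on the Burgers profile** when
`C√λ · N_k^{β/2−b} < 4√2π · c₁` (`= 17.77…` for `c₁ = 1`): then the floor `c₁ Y_{k+1}` of the
register must be met off the core. -/
theorem palasekTowerBreakdown_burgers_lt_floor (R : TowerRates) (k : ℕ) {C l c₁ : ℝ} (hC : 0 ≤ C)
    (hl : 0 < l) (hP : C * Real.sqrt l * R.N k ^ (R.β / 2 - R.b) < 4 * Real.sqrt 2 * π * c₁)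
    (x : EuclideanSpace ℝ (Fin 3)) :
    ‖burgersVortexSwirl (l * R.A k) 1 (C * R.N (k + 1) ^ (R.β - 2)) x‖ < c₁ * R.Y (k + 1) := by
  have hY : 0 < R.Y (k + 1) := Real.rpow_pos_of_pos (R.N_pos _) _
  have hden : 0 < 4 * Real.sqrt 2 * π := by positivity
  refine (palasekTowerBreakdown_burgers_peak_le R k hC hl x).trans_lt ?_
  rw [div_lt_iff₀ hden]
  calc C * Real.sqrt l * R.N k ^ (R.β / 2 - R.b) * R.Y (k + 1)
      < 4 * Real.sqrt 2 * π * c₁ * R.Y (k + 1) := mul_lt_mul_of_pos_right hP hY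
    _ = c₁ * R.Y (k + 1) * (4 * Real.sqrt 2 * π) := by ring

/-! ## §3 The band, the drift, and the register's constants -/

/-- **The Burgers band (necessary form).** If the Burgers child core meets the velocity floor
`c₁ Y_{k+1}` somewhere AND stays under the ceiling `c₂ Y_{k+1}` everywhere, then
`4√2π · c₁ ≤ C√λ · N_k^{β/2−b} ≤ (500π/79) · c₂`. -/
theorem palasekTowerBreakdown_burgers_band (R : TowerRates) (k : ℕ) {C l c₁ c₂ : ℝ} (hC : 0 ≤ C)
    (hl : 0 < l)
    (hfloor : ∃ x : EuclideanSpace ℝ (Fin 3),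
      c₁ * R.Y (k + 1) ≤ ‖burgersVortexSwirl (l * R.A k) 1 (C * R.N (k + 1) ^ (R.β - 2)) x‖)
    (hceil : ∀ x : EuclideanSpace ℝ (Fin 3),
      ‖burgersVortexSwirl (l * R.A k) 1 (C * R.N (k + 1) ^ (R.β - 2)) x‖ ≤ c₂ * R.Y (k + 1)) :
    4 * Real.sqrt 2 * π * c₁ ≤ C * Real.sqrt l * R.N k ^ (R.β / 2 - R.b) ∧
      C * Real.sqrt l * R.N k ^ (R.β / 2 - R.b) ≤ 500 * π / 79 * c₂ := by
  constructor
  · rcases lt_or_ge (C * Real.sqrt l * R.N k ^ (R.β / 2 - R.b)) (4 * Real.sqrt 2 * π * c₁) with h | h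
    · obtain ⟨x, hx⟩ := hfloor
      exact absurd hx (not_le.2 (palasekTowerBreakdown_burgers_lt_floor R k hC hl h x))
    · exact h
  · rcases lt_or_ge (500 * π / 79 * c₂) (C * Real.sqrt l * R.N k ^ (R.β / 2 - R.b)) with h | h
    · obtain ⟨x, hx⟩ := palasekTowerBreakdown_burgers_overshoot R k hC hl h
      exact absurd (hceil x) (not_le.2 hx)
    · exact h

/-- **«Constants drift with k», typed**: for EVERY admissible rates record, every fixed circulation
constant `C > 0`, strain factor `λ > 0` and ceiling constant `c₂`, the Burgers child core overshoots
`c₂ Y_{k+1}` at all sufficiently high levels (the Burgers factor `N_k^{β/2−b} → ∞`). -/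
theorem palasekTowerBreakdown_burgers_eventually_overshoot (R : TowerRates) {C l : ℝ} (hC : 0 < C)
    (hl : 0 < l) (c₂ : ℝ) :
    ∃ k₀ : ℕ, ∀ k, k₀ ≤ k → ∃ x : EuclideanSpace ℝ (Fin 3),
      c₂ * R.Y (k + 1) < ‖burgersVortexSwirl (l * R.A k) 1 (C * R.N (k + 1) ^ (R.β - 2)) x‖ := by
  have hCl : 0 < C * Real.sqrt l := mul_pos hC (Real.sqrt_pos.2 hl)
  have hev := (palasekTowerBreakdown_tendsto_burgersFactor R).eventually_gt_atTop
    (500 * π / 79 * c₂ / (C * Real.sqrt l))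
  obtain ⟨k₀, hk₀⟩ := eventually_atTop.1 hev
  refine ⟨k₀, fun k hk => palasekTowerBreakdown_burgers_overshoot R k hC.le hl ?_⟩
  have h := hk₀ k hk
  rw [div_lt_iff₀ hCl] at h
  linarith

/-- Numerics: `17 < 4√2π` and `500π/79 · (5/3) < 34`, `500π/79 ≤ 20`, `29 ≤ 4√2π · (5/3)`. -/
theorem palasekTowerBreakdown_burgers_constants :
    (17 : ℝ) < 4 * Real.sqrt 2 * π ∧ 500 * π / 79 * (5 / 3 : ℝ) < 34 ∧
      500 * π / 79 * (1 : ℝ) ≤ 20 ∧ (29 : ℝ) ≤ 4 * Real.sqrt 2 * π * (5 / 3) := by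
  have hpi1 := Real.pi_gt_d2
  have hpi2 := Real.pi_lt_d2
  have hs : (1.41 : ℝ) < Real.sqrt 2 := by
    rw [Real.lt_sqrt (by norm_num)]; norm_num
  refine ⟨by nlinarith, by nlinarith, by nlinarith, by nlinarith⟩

/-- **Under the register's constants** (`Schedule.Rigid`: `c₁ = 1`, `c₂ = 5/3`) on the wide rates:
a Burgers child core that meets the registered velocity floor `S.c₁ · Y_{k+1}` by its own swirl and
does not overshoot the registered ceiling `S.c₂ · Y_{k+1}` has `17 < C√λ · N_k^{1/20} < 34`
(sharp band `[19.7, 32.8]`, of width exactly `c₂/c₁ = 5/3`). -/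
theorem palasekTowerBreakdown_burgers_band_rigid (S : Schedule TowerRates.wide) (hS : S.Rigid) (k : ℕ)
    {C l : ℝ} (hC : 0 ≤ C) (hl : 0 < l)
    (hfloor : ∃ x : EuclideanSpace ℝ (Fin 3), S.c₁ * TowerRates.wide.Y (k + 1) ≤
      ‖burgersVortexSwirl (l * TowerRates.wide.A k) 1 (C * TowerRates.wide.N (k + 1) ^ (TowerRates.wide.β - 2)) x‖)
    (hceil : ∀ x : EuclideanSpace ℝ (Fin 3),
      ‖burgersVortexSwirl (l * TowerRates.wide.A k) 1 (C * TowerRates.wide.N (k + 1) ^ (TowerRates.wide.β - 2)) x‖ ≤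
        S.c₂ * TowerRates.wide.Y (k + 1)) :
    17 < C * Real.sqrt l * TowerRates.wide.N k ^ (1 / 20 : ℝ) ∧
      C * Real.sqrt l * TowerRates.wide.N k ^ (1 / 20 : ℝ) < 34 := by
  obtain ⟨h1, h2⟩ := palasekTowerBreakdown_burgers_band TowerRates.wide k hC hl hfloor hceil
  rw [palasekTowerBreakdown_burgers_exponent_wide, hS.c₁_eq] at h1
  rw [palasekTowerBreakdown_burgers_exponent_wide, hS.c₂_eq] at h2
  obtain ⟨c17, c34, -, -⟩ := palasekTowerBreakdown_burgers_constants
  exact ⟨by linarith, by linarith⟩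

/-- **Certified thresholds under the register's constants** (wide rates, `Schedule.Rigid`), with
`P := C√λ · N_k^{1/20}`: `P ≤ 29` ⇒ no overshoot of `S.c₂ Y_{k+1}` anywhere on the Burgers child core;
`P ≥ 34` ⇒ overshoot somewhere; `P ≥ 20` ⇒ the velocity floor `S.c₁ Y_{k+1}` is met on the core;
`P ≤ 17` ⇒ it is missed everywhere on the profile. -/
theorem palasekTowerBreakdown_burgers_thresholds_rigid (S : Schedule TowerRates.wide) (hS : S.Rigid)
    (k : ℕ) {C l : ℝ} (hC : 0 ≤ C) (hl : 0 < l) :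
    (C * Real.sqrt l * TowerRates.wide.N k ^ (1 / 20 : ℝ) ≤ 29 → ∀ x : EuclideanSpace ℝ (Fin 3),
      ‖burgersVortexSwirl (l * TowerRates.wide.A k) 1 (C * TowerRates.wide.N (k + 1) ^ (TowerRates.wide.β - 2)) x‖ ≤
        S.c₂ * TowerRates.wide.Y (k + 1)) ∧
    (34 ≤ C * Real.sqrt l * TowerRates.wide.N k ^ (1 / 20 : ℝ) → ∃ x : EuclideanSpace ℝ (Fin 3),
      S.c₂ * TowerRates.wide.Y (k + 1) <
        ‖burgersVortexSwirl (l * TowerRates.wide.A k) 1 (C * TowerRates.wide.N (k + 1) ^ (TowerRates.wide.β - 2)) x‖) ∧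
    (20 ≤ C * Real.sqrt l * TowerRates.wide.N k ^ (1 / 20 : ℝ) → ∃ x : EuclideanSpace ℝ (Fin 3),
      S.c₁ * TowerRates.wide.Y (k + 1) ≤
        ‖burgersVortexSwirl (l * TowerRates.wide.A k) 1 (C * TowerRates.wide.N (k + 1) ^ (TowerRates.wide.β - 2)) x‖) ∧
    (C * Real.sqrt l * TowerRates.wide.N k ^ (1 / 20 : ℝ) ≤ 17 → ∀ x : EuclideanSpace ℝ (Fin 3),
      ‖burgersVortexSwirl (l * TowerRates.wide.A k) 1 (C * TowerRates.wide.N (k + 1) ^ (TowerRates.wide.β - 2)) x‖ <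
        S.c₁ * TowerRates.wide.Y (k + 1)) := by
  obtain ⟨c17, c34, c20, c29⟩ := palasekTowerBreakdown_burgers_constants
  have he := palasekTowerBreakdown_burgers_exponent_wide
  refine ⟨fun hP x => ?_, fun hP => ?_, fun hP => ?_, fun hP x => ?_⟩
  · refine palasekTowerBreakdown_burgers_noOvershoot TowerRates.wide k hC hl ?_ x
    rw [he, hS.c₂_eq]; linarith
  · refine palasekTowerBreakdown_burgers_overshoot TowerRates.wide k hC hl ?_
    rw [he, hS.c₂_eq]; linarith
  · refine palasekTowerBreakdown_burgers_floor TowerRates.wide k hC hl ?_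
    rw [he, hS.c₁_eq]; linarith
  · refine palasekTowerBreakdown_burgers_lt_floor TowerRates.wide k hC hl ?_ x
    rw [he, hS.c₁_eq]; linarith

/-- **Drift under the register's constants**: on the wide rates with `Schedule.Rigid`, for every
fixed `C, λ > 0` the Burgers child core overshoots the registered ceiling `S.c₂ · Y_{k+1}` at all high
levels. -/
theorem palasekTowerBreakdown_burgers_eventually_overshoot_rigid (S : Schedule TowerRates.wide)
    {C l : ℝ} (hC : 0 < C) (hl : 0 < l) :
    ∃ k₀ : ℕ, ∀ k, k₀ ≤ k → ∃ x : EuclideanSpace ℝ (Fin 3), S.c₂ * TowerRates.wide.Y (k + 1) <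
      ‖burgersVortexSwirl (l * TowerRates.wide.A k) 1 (C * TowerRates.wide.N (k + 1) ^ (TowerRates.wide.β - 2)) x‖ :=
  palasekTowerBreakdown_burgers_eventually_overshoot TowerRates.wide hC hl S.c₂

/-! ## §4 The same-level reading: a core in its own strain, and the core Reynolds number -/

/-- `N_j^{β−2} · A_j^{1/2} = (N_j^{β−2})^{1/2} · Y_j`: a level-`j` Burgers core of circulation
`C N_j^{β−2}` in the strain `λ' A_j` of ITS OWN level has peak `(μ/4π) · C√λ' · Re_j^{1/2} · Y_j`
with `Re_j = N_j^{β−2}` the register's core Reynolds number at `ν = 1`. -/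
theorem palasekTowerBreakdown_burgers_scaling_self (R : TowerRates) (j : ℕ) :
    R.N j ^ (R.β - 2) * Real.sqrt (R.A j) = Real.sqrt (R.N j ^ (R.β - 2)) * R.Y j := by
  have hN := R.N_pos j
  rw [palasekTowerBreakdown_sqrt_A, TowerRates.Y, Real.sqrt_eq_rpow, ← Real.rpow_mul hN.le,
    ← Real.rpow_add hN, ← Real.rpow_add hN]
  congr 1
  ring

/-- **Same-level peak**: every point of the level-`j` Burgers core in its own strain `λ' A_j` has
swirl speed `≤ C√λ' · (N_j^{β−2})^{1/2} · Y_j / (4√2π)`, and some point has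
`≥ (79/125) · C√λ' · (N_j^{β−2})^{1/2} · Y_j / (4π)`; in particular it overshoots `c₂ Y_j` as soon as
`C√λ' · Re_j^{1/2} > (500π/79) c₂` — and `Re_j = N_j^{β−2} → ∞`. -/
theorem palasekTowerBreakdown_burgers_peak_self (R : TowerRates) (j : ℕ) {C l : ℝ} (hC : 0 ≤ C)
    (hl : 0 < l) :
    (∀ x : EuclideanSpace ℝ (Fin 3), ‖burgersVortexSwirl (l * R.A j) 1 (C * R.N j ^ (R.β - 2)) x‖ ≤
        C * Real.sqrt l * Real.sqrt (R.N j ^ (R.β - 2)) * R.Y j / (4 * Real.sqrt 2 * π)) ∧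
      ∃ x : EuclideanSpace ℝ (Fin 3),
        79 / 125 * (C * Real.sqrt l * Real.sqrt (R.N j ^ (R.β - 2)) * R.Y j / (4 * π)) ≤
          ‖burgersVortexSwirl (l * R.A j) 1 (C * R.N j ^ (R.β - 2)) x‖ := by
  have hA := R.A_pos j
  have hΓ : 0 ≤ C * R.N j ^ (R.β - 2) := mul_nonneg hC (Real.rpow_nonneg (R.N_pos _).le _)
  constructor
  · intro x
    have h := norm_burgersVortexSwirl_le_peak (mul_pos hl hA) one_pos (C * R.N j ^ (R.β - 2)) x
    rw [abs_of_nonneg hΓ, div_one, Real.sqrt_mul hl.le] at h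
    refine h.trans (le_of_eq ?_)
    rw [show C * R.N j ^ (R.β - 2) * (Real.sqrt l * Real.sqrt (R.A j)) =
        C * Real.sqrt l * (R.N j ^ (R.β - 2) * Real.sqrt (R.A j)) by ring,
      palasekTowerBreakdown_burgers_scaling_self]
    ring
  · obtain ⟨x, hx⟩ :=
      exists_norm_burgersVortexSwirl_ge (mul_pos hl hA) one_pos (C * R.N j ^ (R.β - 2))
    rw [abs_of_nonneg hΓ, div_one, Real.sqrt_mul hl.le] at hx
    refine ⟨x, le_of_eq_of_le ?_ hx⟩
    rw [show C * R.N j ^ (R.β - 2) * (Real.sqrt l * Real.sqrt (R.A j)) =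
        C * Real.sqrt l * (R.N j ^ (R.β - 2) * Real.sqrt (R.A j)) by ring,
      palasekTowerBreakdown_burgers_scaling_self]
    ring

end Summit.NavierStokesRegularity.FluidComputer.PalasekTowerClayBridge
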